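import Summits.QuantumFields.QCD.Theorems.HeatSlicedQuarksRobustYangMillsHandoverFilledSliceState

/-!
# The first excited min–max level of the QCD transfer operator is strictly positive: `0 < λ₁`
(crux `HeatSlicedQuarks.RobustYangMillsHandover`, item stmt-QuantumFields-8892, line `pin-the-infimum`;
helper towards the held stub `stub_spectralResponse` and the dictionary stub `stub_spectralDictionary`)

Both spectral stubs of the line are stated over
`transferGapAt reg t k S = qcdTransferGap N_f β_k (2S+1) m(k) = Real.log λ₀ − Real.log λ₁`
(`Literature/MathematicalPhysics/QuantumFieldTheory/QCDTransferMatrix.lean`).  Inside their range guard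
(`β ≥ 0`, all bare masses `> −1`) the tree has `0 < λ₀`, `λ₁ ≤ λ₀`, `0 ≤ λ₁` — but `Real.log 0 = 0`, so
without `0 < λ₁` the "gap" could silently be the junk number `log λ₀`.  This file closes that hole:

* `qcdTransferLevel_one_pos` — **`0 < λ₁`** for `N_f ≥ 1`, `β ≥ 0`, `m_f > −1`.  Proof (Reed–Simon XIII.1
  with two explicit trial waves): the constant vacuum wave `Ω : U ↦ |∅⟩` and the constant completely
  filled wave `Ξ : U ↦ |ι⟩` (previous file) are BOTH exact eigen-waves of `T̂_F(U)` with continuous,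
  strictly positive real eigenvalues `a(U) = (det A)²`, `b(U) = T̂_F(U)_{ιι}`, and `|∅⟩ ⊥ |ι⟩` in Fock
  space; hence on the constant waves `W_{x,y} : U ↦ x|∅⟩ + y|ι⟩` both forms are DIAGONAL:
  `𝔫(W,W) = |x|² ∫a + |y|² ∫b`, `𝔱(W,W) = |x|² ∫∫K a a' + |y|² ∫∫K b b'`, all four integrals of continuous
  strictly positive functions, so `R(W) ≥ c := min(R(Ω), R(Ξ)) > 0`.  For ANY constraint wave `Φ` of the
  level-`1` min–max problem some non-zero `W_{x,y}` satisfies `𝔫(Φ, W) = x 𝔫(Φ,Ω) + y 𝔫(Φ,Ξ) = 0`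
  (take `(x, y) = (𝔫(Φ,Ξ), −𝔫(Φ,Ω))`, or `W = Ω` if `𝔫(Φ,Ω) = 0`), whence every constrained supremum is
  `≥ c` and so is their infimum `λ₁`.
* `qcdTransferGap_nonneg`, `qcdTransferGap_eq_neg_log_div` — inside the range guard the gap is the honest
  `−log(λ₁/λ₀) ≥ 0`.

References: M. Reed, B. Simon, *Methods of Modern Mathematical Physics IV*, Thm XIII.1 [ReedSimonIV1978];
M. Lüscher, Commun. Math. Phys. 54 (1977) 283 [Luscher1977, pp. 283–292]; J. Smit, *Introduction to Quantum
Fields on a Lattice*, §6.5 (6.87)–(6.91) [Smit2023].  Pure theorem file.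
-/

noncomputable section

namespace Summit.QuantumFields.QCD.Cruxes.RobustYangMillsHandover.PinTheInfimum

open scoped ComplexOrder ComplexConjugate
open MeasureTheory Matrix Literature.MathematicalPhysics.QuantumFieldTheory
  Literature.MathematicalPhysics.QuantumLattice
open Summit.QuantumFields.QCD.Cruxes.StableActionBridge.Sketch
open Literature.Probability.LatticeModels (TorusSite)
open FilledSliceState TransferVacuumRayleigh

namespace TransferLevelOnePos

variable {Nf S : ℕ} [NeZero S]

/-! ### `T̂_F(U)` on the constant waves `W_{x,y} : U ↦ x|∅⟩ + y|ι⟩` -/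

/-- `T̂_F(U)(x|∅⟩ + y|ι⟩) = (x a(U))|∅⟩ + (y b(U))|ι⟩` with `a = (det A)²`, `b = T̂_F(U)_{ιι}`. [folklore] -/
theorem fermionSliceOp_mulVec_constCombo (U : GaugeConfig 3 S (Matrix.specialUnitaryGroup (Fin 3) ℂ)) (mq : Fin Nf → ℝ) (x y : ℂ) :
    fermionSliceOp U mq *ᵥ (x • (vacuum : Fock (SliceFermiIdx Nf S)) +
        y • Pi.single (Finset.univ : Finset (SliceFermiIdx Nf S)) (1 : ℂ)) =
      (x * (sliceMassHop U mq).det ^ 2) • (vacuum : Fock (SliceFermiIdx Nf S)) +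
        (y * fermionSliceOp U mq Finset.univ Finset.univ) •
          Pi.single (Finset.univ : Finset (SliceFermiIdx Nf S)) (1 : ℂ) := by
  rw [Matrix.mulVec_add, Matrix.mulVec_smul, Matrix.mulVec_smul, fermionSliceOp_mulVec_vacuum,
    fermionSliceOp_mulVec_filled, smul_smul, smul_smul]

/-- The `𝔫`-integrand of a core wave `Φ` against `W_{x,y}`:
`⟨Φ(U), T̂_F(U) W_{x,y}⟩ = x · a(U)⟨Φ(U)|∅⟩ + y · b(U)⟨Φ(U)|ι⟩`. [folklore] -/
theorem weight_integrand_constCombo (U : GaugeConfig 3 S (Matrix.specialUnitaryGroup (Fin 3) ℂ)) (mq : Fin Nf → ℝ) (v : Fock (SliceFermiIdx Nf S))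
    (x y : ℂ) :
    star v ⬝ᵥ (fermionSliceOp U mq *ᵥ (x • (vacuum : Fock (SliceFermiIdx Nf S)) +
        y • Pi.single (Finset.univ : Finset (SliceFermiIdx Nf S)) (1 : ℂ))) =
      x * ((sliceMassHop U mq).det ^ 2 * (star v ⬝ᵥ (vacuum : Fock (SliceFermiIdx Nf S)))) +
        y * (fermionSliceOp U mq Finset.univ Finset.univ *
          (star v ⬝ᵥ Pi.single (Finset.univ : Finset (SliceFermiIdx Nf S)) (1 : ℂ))) := by
  rw [fermionSliceOp_mulVec_constCombo, dotProduct_add, dotProduct_smul, dotProduct_smul, smul_eq_mul,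
    smul_eq_mul]
  ring

variable [NeZero Nf]

omit [NeZero Nf] in
/-- **`𝔫(Φ, W_{x,y}) = x 𝔫(Φ, Ω) + y 𝔫(Φ, Ξ)`** for a continuous wave `Φ` (linearity of the weighted pairing in
its second argument on the constant waves; all integrands are continuous on the compact slice). [folklore] -/
theorem fermionWeightForm_constCombo_right (mq : Fin Nf → ℝ) (hm : ∀ f, -1 < mq f) {Φ : SliceWave Nf S}
    (hΦ : Continuous Φ) (x y : ℂ) :
    fermionWeightForm mq Φ (fun _ => x • (vacuum : Fock (SliceFermiIdx Nf S)) +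
        y • Pi.single (Finset.univ : Finset (SliceFermiIdx Nf S)) (1 : ℂ)) =
      x * fermionWeightForm mq Φ (fun _ => (vacuum : Fock (SliceFermiIdx Nf S))) +
        y * fermionWeightForm mq Φ (fun _ => Pi.single (Finset.univ : Finset (SliceFermiIdx Nf S)) (1 : ℂ)) := by
  unfold fermionWeightForm
  have hstar : Continuous fun U : GaugeConfig 3 S (Matrix.specialUnitaryGroup (Fin 3) ℂ) => star (Φ U) := hΦ.star
  have ha : Continuous fun U : GaugeConfig 3 S (Matrix.specialUnitaryGroup (Fin 3) ℂ) => (sliceMassHop (Nf := Nf) U mq).det ^ 2 :=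
    (FermionSliceContinuous.continuous_sliceMassHop_det mq).pow 2
  have hb : Continuous fun U : GaugeConfig 3 S (Matrix.specialUnitaryGroup (Fin 3) ℂ) => fermionSliceOp (Nf := Nf) U mq Finset.univ Finset.univ :=
    (continuous_fermionSliceOp Nf S mq hm).matrix_elem Finset.univ Finset.univ
  have h1 : Integrable (fun U : GaugeConfig 3 S (Matrix.specialUnitaryGroup (Fin 3) ℂ) => x * ((sliceMassHop U mq).det ^ 2 *
      (star (Φ U) ⬝ᵥ (vacuum : Fock (SliceFermiIdx Nf S))))) (sliceHaar S) :=
    integrable_sliceHaar_of_continuous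
      (continuous_const.mul (ha.mul (hstar.dotProduct continuous_const)))
  have h2 : Integrable (fun U : GaugeConfig 3 S (Matrix.specialUnitaryGroup (Fin 3) ℂ) => y * (fermionSliceOp U mq Finset.univ Finset.univ *
      (star (Φ U) ⬝ᵥ Pi.single (Finset.univ : Finset (SliceFermiIdx Nf S)) (1 : ℂ)))) (sliceHaar S) :=
    integrable_sliceHaar_of_continuous
      (continuous_const.mul (hb.mul (hstar.dotProduct continuous_const)))
  simp_rw [weight_integrand_constCombo]
  rw [integral_add h1 h2, integral_const_mul, integral_const_mul]
  congr 1
  · congr 1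
    refine integral_congr_ae (Filter.Eventually.of_forall fun U => ?_)
    simp only [fermionSliceOp_mulVec_vacuum, dotProduct_smul, smul_eq_mul]
  · congr 1
    refine integral_congr_ae (Filter.Eventually.of_forall fun U => ?_)
    simp only [fermionSliceOp_mulVec_filled, dotProduct_smul, smul_eq_mul]

/-- **`𝔫(W_{x,y}, W_{x,y}) = |x|² ∫ a + |y|² ∫ b`** (real and diagonal: `|∅⟩ ⊥ |ι⟩`, both eigenvalues real).
[folklore] -/
theorem fermionWeightForm_constCombo_self (mq : Fin Nf → ℝ) (hm : ∀ f, -1 < mq f) (x y : ℂ) :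
    fermionWeightForm mq (fun _ : GaugeConfig 3 S (Matrix.specialUnitaryGroup (Fin 3) ℂ) => x • (vacuum : Fock (SliceFermiIdx Nf S)) +
        y • Pi.single (Finset.univ : Finset (SliceFermiIdx Nf S)) (1 : ℂ))
      (fun _ => x • (vacuum : Fock (SliceFermiIdx Nf S)) +
        y • Pi.single (Finset.univ : Finset (SliceFermiIdx Nf S)) (1 : ℂ)) =
      star x * x * ((∫ U, ((sliceMassHop (Nf := Nf) U mq).det ^ 2).re ∂(sliceHaar S) : ℝ) : ℂ) +
        star y * y * ((∫ U, (fermionSliceOp (Nf := Nf) U mq Finset.univ Finset.univ).re ∂(sliceHaar S) : ℝ) : ℂ) := by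
  unfold fermionWeightForm
  have hint : ∀ U : GaugeConfig 3 S (Matrix.specialUnitaryGroup (Fin 3) ℂ),
      star (x • (vacuum : Fock (SliceFermiIdx Nf S)) +
            y • Pi.single (Finset.univ : Finset (SliceFermiIdx Nf S)) (1 : ℂ)) ⬝ᵥ
          (fermionSliceOp U mq *ᵥ (x • (vacuum : Fock (SliceFermiIdx Nf S)) +
            y • Pi.single (Finset.univ : Finset (SliceFermiIdx Nf S)) (1 : ℂ))) =
        star x * x * ((((sliceMassHop (Nf := Nf) U mq).det ^ 2).re : ℝ) : ℂ) +
          star y * y * (((fermionSliceOp (Nf := Nf) U mq Finset.univ Finset.univ).re : ℝ) : ℂ) := by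
    intro U
    rw [fermionSliceOp_mulVec_constCombo, star_constCombo_dotProduct, ofReal_det_sq_re U mq hm,
      ofReal_fermionSliceOp_univ_univ_re U mq hm]
    ring
  have h1 : Integrable (fun U : GaugeConfig 3 S (Matrix.specialUnitaryGroup (Fin 3) ℂ) =>
      star x * x * ((((sliceMassHop (Nf := Nf) U mq).det ^ 2).re : ℝ) : ℂ)) (sliceHaar S) :=
    integrable_sliceHaar_of_continuous
      (continuous_const.mul (Complex.continuous_ofReal.comp (continuous_det_sq_re mq)))
  have h2 : Integrable (fun U : GaugeConfig 3 S (Matrix.specialUnitaryGroup (Fin 3) ℂ) =>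
      star y * y * (((fermionSliceOp (Nf := Nf) U mq Finset.univ Finset.univ).re : ℝ) : ℂ)) (sliceHaar S) :=
    integrable_sliceHaar_of_continuous
      (continuous_const.mul (Complex.continuous_ofReal.comp (continuous_fermionSliceOp_univ_univ_re mq hm)))
  simp_rw [hint]
  rw [integral_add h1 h2, integral_const_mul, integral_const_mul, integral_complex_ofReal,
    integral_complex_ofReal]

/-- The `𝔱`-integrand on `W_{x,y}`: `K ⟨T̂_F W, T̂_F' W⟩ = conj x·x·(K a a') + conj y·y·(K b b')`. [folklore] -/
theorem transfer_integrand_constCombo (β : ℝ) (mq : Fin Nf → ℝ) (hm : ∀ f, -1 < mq f) (x y : ℂ)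
    (U U' : GaugeConfig 3 S (Matrix.specialUnitaryGroup (Fin 3) ℂ)) :
    (gaugeSliceKernel β U U' : ℂ) *
        (star (fermionSliceOp U mq *ᵥ (x • (vacuum : Fock (SliceFermiIdx Nf S)) +
            y • Pi.single (Finset.univ : Finset (SliceFermiIdx Nf S)) (1 : ℂ))) ⬝ᵥ
          (fermionSliceOp U' mq *ᵥ (x • (vacuum : Fock (SliceFermiIdx Nf S)) +
            y • Pi.single (Finset.univ : Finset (SliceFermiIdx Nf S)) (1 : ℂ)))) =
      star x * x * ((gaugeSliceKernel β U U' *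
          (((sliceMassHop (Nf := Nf) U mq).det ^ 2).re * ((sliceMassHop (Nf := Nf) U' mq).det ^ 2).re) : ℝ) : ℂ) +
        star y * y * ((gaugeSliceKernel β U U' *
          ((fermionSliceOp (Nf := Nf) U mq Finset.univ Finset.univ).re *
            (fermionSliceOp (Nf := Nf) U' mq Finset.univ Finset.univ).re) : ℝ) : ℂ) := by
  rw [fermionSliceOp_mulVec_constCombo, fermionSliceOp_mulVec_constCombo, star_constCombo_dotProduct]
  have ha : ∀ V : GaugeConfig 3 S (Matrix.specialUnitaryGroup (Fin 3) ℂ), star ((sliceMassHop (Nf := Nf) V mq).det ^ 2) = (sliceMassHop V mq).det ^ 2 :=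
    fun V => by
    rw [Complex.star_def]
    exact Complex.conj_eq_iff_im.2 (det_sq_re_pos_and_im_eq_zero V mq hm).2
  have hb : ∀ V : GaugeConfig 3 S (Matrix.specialUnitaryGroup (Fin 3) ℂ), star (fermionSliceOp (Nf := Nf) V mq Finset.univ Finset.univ) =
      fermionSliceOp V mq Finset.univ Finset.univ := fun V => by
    rw [Complex.star_def]
    exact Complex.conj_eq_iff_im.2 (fermionSliceOp_univ_univ_pos V mq hm).2
  rw [star_mul', star_mul', ha, hb]
  push_cast
  rw [ofReal_det_sq_re U mq hm, ofReal_det_sq_re U' mq hm, ofReal_fermionSliceOp_univ_univ_re U mq hm,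
    ofReal_fermionSliceOp_univ_univ_re U' mq hm]
  ring

/-- **`𝔱(W_{x,y}, W_{x,y}) = |x|² ∫∫ K a a' + |y|² ∫∫ K b b'`** (real and diagonal). [folklore] -/
theorem transferForm_constCombo_self (β : ℝ) (mq : Fin Nf → ℝ) (hm : ∀ f, -1 < mq f) (x y : ℂ) :
    transferForm β mq (fun _ : GaugeConfig 3 S (Matrix.specialUnitaryGroup (Fin 3) ℂ) => x • (vacuum : Fock (SliceFermiIdx Nf S)) +
        y • Pi.single (Finset.univ : Finset (SliceFermiIdx Nf S)) (1 : ℂ))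
      (fun _ => x • (vacuum : Fock (SliceFermiIdx Nf S)) +
        y • Pi.single (Finset.univ : Finset (SliceFermiIdx Nf S)) (1 : ℂ)) =
      star x * x * ((∫ U, ∫ U', gaugeSliceKernel β U U' *
          (((sliceMassHop (Nf := Nf) U mq).det ^ 2).re * ((sliceMassHop (Nf := Nf) U' mq).det ^ 2).re)
          ∂(sliceHaar S) ∂(sliceHaar S) : ℝ) : ℂ) +
        star y * y * ((∫ U, ∫ U', gaugeSliceKernel β U U' *
          ((fermionSliceOp (Nf := Nf) U mq Finset.univ Finset.univ).re *
            (fermionSliceOp (Nf := Nf) U' mq Finset.univ Finset.univ).re)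
          ∂(sliceHaar S) ∂(sliceHaar S) : ℝ) : ℂ) := by
  unfold transferForm
  simp_rw [transfer_integrand_constCombo β mq hm x y]
  -- the two real integrands, jointly continuous on the product of slices
  set Fa : GaugeConfig 3 S (Matrix.specialUnitaryGroup (Fin 3) ℂ) × GaugeConfig 3 S (Matrix.specialUnitaryGroup (Fin 3) ℂ) → ℝ := fun p => gaugeSliceKernel β p.1 p.2 *
      (((sliceMassHop (Nf := Nf) p.1 mq).det ^ 2).re * ((sliceMassHop (Nf := Nf) p.2 mq).det ^ 2).re) with hFa
  set Fb : GaugeConfig 3 S (Matrix.specialUnitaryGroup (Fin 3) ℂ) × GaugeConfig 3 S (Matrix.specialUnitaryGroup (Fin 3) ℂ) → ℝ := fun p => gaugeSliceKernel β p.1 p.2 *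
      ((fermionSliceOp (Nf := Nf) p.1 mq Finset.univ Finset.univ).re *
        (fermionSliceOp (Nf := Nf) p.2 mq Finset.univ Finset.univ).re) with hFb
  have hra := continuous_det_sq_re (Nf := Nf) (S := S) mq
  have hrb := continuous_fermionSliceOp_univ_univ_re (Nf := Nf) (S := S) mq hm
  have hFa_cont : Continuous Fa :=
    (continuous_gaugeSliceKernel S β).mul ((hra.comp continuous_fst).mul (hra.comp continuous_snd))
  have hFb_cont : Continuous Fb :=
    (continuous_gaugeSliceKernel S β).mul ((hrb.comp continuous_fst).mul (hrb.comp continuous_snd))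
  -- inner integrals
  have hinner : ∀ U : GaugeConfig 3 S (Matrix.specialUnitaryGroup (Fin 3) ℂ),
      ∫ U', (star x * x * ((Fa (U, U') : ℝ) : ℂ) + star y * y * ((Fb (U, U') : ℝ) : ℂ)) ∂(sliceHaar S) =
        star x * x * ((∫ U', Fa (U, U') ∂(sliceHaar S) : ℝ) : ℂ) +
          star y * y * ((∫ U', Fb (U, U') ∂(sliceHaar S) : ℝ) : ℂ) := by
    intro U
    have h1 : Integrable (fun U' : GaugeConfig 3 S (Matrix.specialUnitaryGroup (Fin 3) ℂ) => star x * x * ((Fa (U, U') : ℝ) : ℂ)) (sliceHaar S) :=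
      integrable_sliceHaar_of_continuous (continuous_const.mul
        (Complex.continuous_ofReal.comp (hFa_cont.comp (Continuous.prodMk_right U))))
    have h2 : Integrable (fun U' : GaugeConfig 3 S (Matrix.specialUnitaryGroup (Fin 3) ℂ) => star y * y * ((Fb (U, U') : ℝ) : ℂ)) (sliceHaar S) :=
      integrable_sliceHaar_of_continuous (continuous_const.mul
        (Complex.continuous_ofReal.comp (hFb_cont.comp (Continuous.prodMk_right U))))
    rw [integral_add h1 h2, integral_const_mul, integral_const_mul, integral_complex_ofReal,
      integral_complex_ofReal]
  have hFa' : ∀ U U' : GaugeConfig 3 S (Matrix.specialUnitaryGroup (Fin 3) ℂ), gaugeSliceKernel β U U' *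
      (((sliceMassHop (Nf := Nf) U mq).det ^ 2).re * ((sliceMassHop (Nf := Nf) U' mq).det ^ 2).re) = Fa (U, U') :=
    fun _ _ => rfl
  have hFb' : ∀ U U' : GaugeConfig 3 S (Matrix.specialUnitaryGroup (Fin 3) ℂ), gaugeSliceKernel β U U' *
      ((fermionSliceOp (Nf := Nf) U mq Finset.univ Finset.univ).re *
        (fermionSliceOp (Nf := Nf) U' mq Finset.univ Finset.univ).re) = Fb (U, U') := fun _ _ => rfl
  simp_rw [hFa', hFb', hinner]
  -- outer integral
  have h1 : Integrable (fun U : GaugeConfig 3 S (Matrix.specialUnitaryGroup (Fin 3) ℂ) =>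
      star x * x * ((∫ U', Fa (U, U') ∂(sliceHaar S) : ℝ) : ℂ)) (sliceHaar S) :=
    ((integrable_inner_integral_sliceHaar hFa_cont).ofReal).const_mul _
  have h2 : Integrable (fun U : GaugeConfig 3 S (Matrix.specialUnitaryGroup (Fin 3) ℂ) =>
      star y * y * ((∫ U', Fb (U, U') ∂(sliceHaar S) : ℝ) : ℂ)) (sliceHaar S) :=
    ((integrable_inner_integral_sliceHaar hFb_cont).ofReal).const_mul _
  rw [integral_add h1 h2, integral_const_mul, integral_const_mul, integral_complex_ofReal,
    integral_complex_ofReal]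

/-! ### The four positive constants and the Rayleigh quotient on the constant waves -/

omit [NeZero Nf] in
/-- `N₀ = ∫ a > 0`, `N₁ = ∫ b > 0`, `T₀ = ∫∫ K a a' > 0`, `T₁ = ∫∫ K b b' > 0` (integrals of continuous strictly
positive functions on the compact slices). [folklore] -/
theorem four_constants_pos (β : ℝ) (mq : Fin Nf → ℝ) (hm : ∀ f, -1 < mq f) :
    0 < ∫ U, ((sliceMassHop (Nf := Nf) (S := S) U mq).det ^ 2).re ∂(sliceHaar S) ∧
    0 < ∫ U, (fermionSliceOp (Nf := Nf) (S := S) U mq Finset.univ Finset.univ).re ∂(sliceHaar S) ∧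
    0 < ∫ U, ∫ U', gaugeSliceKernel β U U' *
          (((sliceMassHop (Nf := Nf) (S := S) U mq).det ^ 2).re * ((sliceMassHop (Nf := Nf) U' mq).det ^ 2).re)
          ∂(sliceHaar S) ∂(sliceHaar S) ∧
    0 < ∫ U, ∫ U', gaugeSliceKernel β U U' *
          ((fermionSliceOp (Nf := Nf) (S := S) U mq Finset.univ Finset.univ).re *
            (fermionSliceOp (Nf := Nf) U' mq Finset.univ Finset.univ).re)
          ∂(sliceHaar S) ∂(sliceHaar S) := by
  have hra := continuous_det_sq_re (Nf := Nf) (S := S) mq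
  have hrb := continuous_fermionSliceOp_univ_univ_re (Nf := Nf) (S := S) mq hm
  refine ⟨integral_sliceHaar_pos hra fun U => (det_sq_re_pos_and_im_eq_zero U mq hm).1,
    integral_sliceHaar_pos hrb fun U => (fermionSliceOp_univ_univ_pos U mq hm).1, ?_, ?_⟩
  · exact double_integral_sliceHaar_pos
      (F := fun p => gaugeSliceKernel β p.1 p.2 *
        (((sliceMassHop (Nf := Nf) p.1 mq).det ^ 2).re * ((sliceMassHop (Nf := Nf) p.2 mq).det ^ 2).re))
      ((continuous_gaugeSliceKernel S β).mul ((hra.comp continuous_fst).mul (hra.comp continuous_snd)))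
      fun p => mul_pos (gaugeSliceKernel_pos β p.1 p.2)
        (mul_pos (det_sq_re_pos_and_im_eq_zero p.1 mq hm).1 (det_sq_re_pos_and_im_eq_zero p.2 mq hm).1)
  · exact double_integral_sliceHaar_pos
      (F := fun p => gaugeSliceKernel β p.1 p.2 *
        ((fermionSliceOp (Nf := Nf) p.1 mq Finset.univ Finset.univ).re *
          (fermionSliceOp (Nf := Nf) p.2 mq Finset.univ Finset.univ).re))
      ((continuous_gaugeSliceKernel S β).mul ((hrb.comp continuous_fst).mul (hrb.comp continuous_snd)))
      fun p => mul_pos (gaugeSliceKernel_pos β p.1 p.2)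
        (mul_pos (fermionSliceOp_univ_univ_pos p.1 mq hm).1 (fermionSliceOp_univ_univ_pos p.2 mq hm).1)

/-- `Re (conj x · x · r) = ‖x‖² r` and `Im (conj x · x · r) = 0` for real `r`. [folklore] -/
theorem re_star_mul_self_mul_ofReal (x : ℂ) (r : ℝ) :
    (star x * x * (r : ℂ)).re = ‖x‖ ^ 2 * r := by
  rw [Complex.star_def, ← Complex.normSq_eq_conj_mul_self, ← Complex.ofReal_mul, Complex.ofReal_re,
    Complex.normSq_eq_norm_sq]

/-- **A weighted mean of two ratios is at least the smaller ratio**: for `p, q ≥ 0` not both zero... here in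
the form used below: if `c ≤ T₀/N₀`, `c ≤ T₁/N₁` with `N₀, N₁ > 0` and `p, q ≥ 0`, `0 < p N₀ + q N₁`, then
`c ≤ (p T₀ + q T₁)/(p N₀ + q N₁)`. [folklore] -/
theorem min_ratio_le_weighted {c T₀ T₁ N₀ N₁ p q : ℝ} (hN₀ : 0 < N₀) (hN₁ : 0 < N₁) (h₀ : c ≤ T₀ / N₀)
    (h₁ : c ≤ T₁ / N₁) (hp : 0 ≤ p) (hq : 0 ≤ q) (hden : 0 < p * N₀ + q * N₁) :
    c ≤ (p * T₀ + q * T₁) / (p * N₀ + q * N₁) := by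
  rw [le_div_iff₀ hden]
  have h₀' : c * N₀ ≤ T₀ := (le_div_iff₀ hN₀).mp h₀
  have h₁' : c * N₁ ≤ T₁ := (le_div_iff₀ hN₁).mp h₁
  nlinarith [mul_le_mul_of_nonneg_left h₀' hp, mul_le_mul_of_nonneg_left h₁' hq]

/-! ### The main theorem -/

/-- **The first excited min–max level of the QCD transfer operator is strictly positive**: for `N_f ≥ 1`,
`β ≥ 0` and all bare quark masses `m_f > −1`, `0 < qcdTransferLevel N_f S β m 1`.  Quantitatively
`λ₁ ≥ c := min (R(Ω)) (R(Ξ))` with `Ω`/`Ξ` the constant vacuum / completely-filled waves: every constraint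
wave `Φ` of the level-`1` problem admits the non-zero trial wave `W = 𝔫(Φ,Ξ)·Ω − 𝔫(Φ,Ω)·Ξ` (or `Ω` itself
when `𝔫(Φ,Ω) = 0`), which is a core wave, `𝔫`-orthogonal to `Φ`, with `𝔫(W,W) ≠ 0` and `R(W) ≥ c` because
both forms are diagonal on `span(Ω, Ξ)` with strictly positive diagonal entries.
[cite: ReedSimonIV1978, Thm XIII.1] [cite: Luscher1977, pp. 283–292] [cite: Smit2023, §6.5 (6.87)–(6.91)] -/
theorem qcdTransferLevel_one_pos (β : ℝ) (mq : Fin Nf → ℝ) (hβ : 0 ≤ β) (hm : ∀ f, -1 < mq f) :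
    0 < qcdTransferLevel Nf S β mq 1 := by
  obtain ⟨hN₀, hN₁, hT₀, hT₁⟩ := four_constants_pos (Nf := Nf) (S := S) β mq hm
  -- names for the four constants
  set N₀ : ℝ := ∫ U, ((sliceMassHop (Nf := Nf) (S := S) U mq).det ^ 2).re ∂(sliceHaar S) with hN₀def
  set N₁ : ℝ := ∫ U, (fermionSliceOp (Nf := Nf) (S := S) U mq Finset.univ Finset.univ).re ∂(sliceHaar S)
    with hN₁def
  set T₀ : ℝ := ∫ U, ∫ U', gaugeSliceKernel β U U' *
      (((sliceMassHop (Nf := Nf) (S := S) U mq).det ^ 2).re * ((sliceMassHop (Nf := Nf) U' mq).det ^ 2).re)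
      ∂(sliceHaar S) ∂(sliceHaar S) with hT₀def
  set T₁ : ℝ := ∫ U, ∫ U', gaugeSliceKernel β U U' *
      ((fermionSliceOp (Nf := Nf) (S := S) U mq Finset.univ Finset.univ).re *
        (fermionSliceOp (Nf := Nf) U' mq Finset.univ Finset.univ).re)
      ∂(sliceHaar S) ∂(sliceHaar S) with hT₁def
  set c : ℝ := min (T₀ / N₀) (T₁ / N₁) with hcdef
  have hc : 0 < c := lt_min (div_pos hT₀ hN₀) (div_pos hT₁ hN₁)
  -- the Rayleigh quotient of a non-zero constant wave is at least `c`
  have hR : ∀ x y : ℂ, (x ≠ 0 ∨ y ≠ 0) →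
      c ≤ transferRayleigh β mq (fun _ : GaugeConfig 3 S (Matrix.specialUnitaryGroup (Fin 3) ℂ) => x • (vacuum : Fock (SliceFermiIdx Nf S)) +
        y • Pi.single (Finset.univ : Finset (SliceFermiIdx Nf S)) (1 : ℂ)) ∧
      (fermionWeightForm mq (fun _ : GaugeConfig 3 S (Matrix.specialUnitaryGroup (Fin 3) ℂ) => x • (vacuum : Fock (SliceFermiIdx Nf S)) +
        y • Pi.single (Finset.univ : Finset (SliceFermiIdx Nf S)) (1 : ℂ))
        (fun _ => x • (vacuum : Fock (SliceFermiIdx Nf S)) +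
          y • Pi.single (Finset.univ : Finset (SliceFermiIdx Nf S)) (1 : ℂ))).re ≠ 0 := by
    intro x y hxy
    have hnum : (transferForm β mq (fun _ : GaugeConfig 3 S (Matrix.specialUnitaryGroup (Fin 3) ℂ) => x • (vacuum : Fock (SliceFermiIdx Nf S)) +
        y • Pi.single (Finset.univ : Finset (SliceFermiIdx Nf S)) (1 : ℂ))
        (fun _ => x • (vacuum : Fock (SliceFermiIdx Nf S)) +
          y • Pi.single (Finset.univ : Finset (SliceFermiIdx Nf S)) (1 : ℂ))).re =
        ‖x‖ ^ 2 * T₀ + ‖y‖ ^ 2 * T₁ := by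
      rw [transferForm_constCombo_self β mq hm x y, Complex.add_re, re_star_mul_self_mul_ofReal,
        re_star_mul_self_mul_ofReal]
    have hden : (fermionWeightForm mq (fun _ : GaugeConfig 3 S (Matrix.specialUnitaryGroup (Fin 3) ℂ) => x • (vacuum : Fock (SliceFermiIdx Nf S)) +
        y • Pi.single (Finset.univ : Finset (SliceFermiIdx Nf S)) (1 : ℂ))
        (fun _ => x • (vacuum : Fock (SliceFermiIdx Nf S)) +
          y • Pi.single (Finset.univ : Finset (SliceFermiIdx Nf S)) (1 : ℂ))).re =
        ‖x‖ ^ 2 * N₀ + ‖y‖ ^ 2 * N₁ := by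
      rw [fermionWeightForm_constCombo_self mq hm x y, Complex.add_re, re_star_mul_self_mul_ofReal,
        re_star_mul_self_mul_ofReal]
    have hpos : 0 < ‖x‖ ^ 2 * N₀ + ‖y‖ ^ 2 * N₁ := by
      rcases hxy with hx | hy
      · have : 0 < ‖x‖ ^ 2 := by positivity
        nlinarith [mul_pos this hN₀, mul_nonneg (sq_nonneg ‖y‖) hN₁.le]
      · have : 0 < ‖y‖ ^ 2 := by positivity
        nlinarith [mul_pos this hN₁, mul_nonneg (sq_nonneg ‖x‖) hN₀.le]
    refine ⟨?_, by rw [hden]; exact hpos.ne'⟩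
    unfold transferRayleigh
    rw [hnum, hden]
    exact min_ratio_le_weighted hN₀ hN₁ (min_le_left _ _) (min_le_right _ _) (sq_nonneg _) (sq_nonneg _) hpos
  -- every constrained supremum of the level-1 problem is at least `c`
  have hsup : ∀ Φ : Fin 1 → SliceWave Nf S, (∀ i, Φ i ∈ transferCore Nf S) →
      c ≤ sSup (transferRayleigh β mq '' {Ψ | Ψ ∈ transferCore Nf S ∧ fermionWeightForm mq Ψ Ψ ≠ 0 ∧
        ∀ i, fermionWeightForm mq (Φ i) Ψ = 0}) := by
    intro Φ hΦ
    have hΦc : Continuous (Φ 0) := (hΦ 0).1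
    -- the two pairings of the constraint wave with the basis waves
    set p : ℂ := fermionWeightForm mq (Φ 0) (fun _ : GaugeConfig 3 S (Matrix.specialUnitaryGroup (Fin 3) ℂ) => (vacuum : Fock (SliceFermiIdx Nf S)))
      with hpdef
    set q : ℂ := fermionWeightForm mq (Φ 0)
      (fun _ : GaugeConfig 3 S (Matrix.specialUnitaryGroup (Fin 3) ℂ) => Pi.single (Finset.univ : Finset (SliceFermiIdx Nf S)) (1 : ℂ)) with hqdef
    -- the trial wave: coefficients `(q, -p)` unless `p = 0`, in which case `(1, 0)` (the vacuum wave)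
    obtain ⟨x, y, hxy, horth⟩ : ∃ x y : ℂ, (x ≠ 0 ∨ y ≠ 0) ∧ x * p + y * q = 0 := by
      by_cases hp : p = 0
      · exact ⟨1, 0, Or.inl one_ne_zero, by rw [hp]; ring⟩
      · exact ⟨q, -p, Or.inr (neg_ne_zero.mpr hp), by ring⟩
    obtain ⟨hRW, hnW⟩ := hR x y hxy
    refine le_trans hRW (le_csSup
      (TransferLevelOrder.bddAbove_transferRayleigh_image hβ hm (TransferLevelOrder.continuous_of_mem_constraint Φ))
      ⟨_, ⟨constWave_mem_transferCore x y, fun h => hnW (by rw [h, Complex.zero_re]), fun i => ?_⟩, rfl⟩)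
    -- the constraint: `𝔫(Φ 0, W) = x p + y q = 0`
    have hi : i = 0 := Subsingleton.elim i 0
    subst hi
    rw [fermionWeightForm_constCombo_right mq hm hΦc x y]
    exact horth
  -- hence so is their infimum `λ₁`
  refine lt_of_lt_of_le hc ?_
  unfold qcdTransferLevel
  refine le_csInf (TransferLevelOrder.qcdTransferLevel_set_nonempty β mq 1) ?_
  rintro _ ⟨Φ, hΦ, rfl⟩
  exact hsup Φ hΦ

end TransferLevelOnePos

/-- **`0 < λ₁`** for the QCD transfer operator with `N_f ≥ 1` flavours of `r = 1` Wilson quarks, `β ≥ 0` and all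
bare masses `m_f > −1` (registered sub-goal `qcdTransferLevel_one_pos` of crux stmt-QuantumFields-8892, line `pin-the-infimum`;
statement-level export of `TransferLevelOnePos.qcdTransferLevel_one_pos`).
[cite: ReedSimonIV1978, Thm XIII.1] [cite: Luscher1977, pp. 283–292] -/
theorem qcdTransferLevel_one_pos : ∀ (Nf S : ℕ) [NeZero Nf] [NeZero S] (β : ℝ) (mq : Fin Nf → ℝ), 0 ≤ β → (∀ f, -1 < mq f) → 0 < qcdTransferLevel Nf S β mq 1 :=
  fun _ _ _ _ β mq hβ hm => TransferLevelOnePos.qcdTransferLevel_one_pos β mq hβ hm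

/-- **Inside the range guard the transfer-matrix gap is the honest `−log(λ₁/λ₀)`**: for `N_f ≥ 1`, `β ≥ 0`,
`m_f > −1`, `qcdTransferGap N_f β S m = −log(λ₁/λ₀)` with `0 < λ₁ ≤ λ₀` (no junk `Real.log 0` is consulted).
[cite: Luscher1977, pp. 283–292] [cite: ReedSimonIV1978, Thm XIII.1] -/
theorem qcdTransferGap_eq_neg_log_div (Nf S : ℕ) [NeZero Nf] [NeZero S] (β : ℝ) (mq : Fin Nf → ℝ)
    (hβ : 0 ≤ β) (hm : ∀ f, -1 < mq f) :
    qcdTransferGap Nf β S mq = -Real.log (qcdTransferLevel Nf S β mq 1 / qcdTransferLevel Nf S β mq 0) := by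
  rw [qcdTransferGap_eq, Real.log_div (qcdTransferLevel_one_pos Nf S β mq hβ hm).ne'
    (TransferLevelBounds.qcdTransferLevel_zero_pos hβ hm).ne']
  ring

/-- **The transfer-matrix gap is non-negative inside the range guard**: `0 ≤ qcdTransferGap N_f β S m` for
`N_f ≥ 1`, `β ≥ 0`, `m_f > −1` (`0 < λ₁ ≤ λ₀` and `log` is monotone). [cite: Luscher1977, pp. 283–292] -/
theorem qcdTransferGap_nonneg (Nf S : ℕ) [NeZero Nf] [NeZero S] (β : ℝ) (mq : Fin Nf → ℝ)
    (hβ : 0 ≤ β) (hm : ∀ f, -1 < mq f) : 0 ≤ qcdTransferGap Nf β S mq := by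
  rw [qcdTransferGap_eq, sub_nonneg]
  exact Real.log_le_log (qcdTransferLevel_one_pos Nf S β mq hβ hm)
    (qcdTransferLevel_one_le_zero Nf S β mq hβ hm)

end Summit.QuantumFields.QCD.Cruxes.RobustYangMillsHandover.PinTheInfimum

end
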